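import Literature.AlgebraicGeometry.HodgeTheory.FermatSurfaceHodgeCharacterEightDvdNineNoUnit
import Literature.AlgebraicGeometry.Shioda1982.StandardQuadrupleLetter
import HarnessLib

/-!
# No exceptional quadruple at the levels `8 ∣ m`, `9 ∣ m` with a good prime (Aoki 1983, Thm. C; Aoki–Shioda 1983, (𝔅²ₘ)(ii))

Everything PROVED (no named facts, no definitions). The multiset / letter form of
`HodgeTheory/FermatSurfaceHodgeCharacterEightDvdNineNoUnit.lean`
(`standard_of_isHodge_eightDvd_nine` = [Aoki1983, Thm. C] at the levels `m` with `8 ∣ m`,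
`9 ∣ m`, `m` carrying a prime `p ≥ 11` or `p ≥ 5` with `p² ∣ m`; function level), in the
vocabulary of `Shioda1982/ExceptionalQuadruples.lean` ([MeyerNeutsch1981Fermatquadrupel]
standard / exceptional quadruples) and in the letter of the tree's named fact
`HodgeTheory.AokiShioda1983_thmB2m_standard`:
* **`isStandardQuadruple_of_eightDvd_nine`**: the multiset of values of an indecomposable
  primitive Hodge character of length `4` and such a level is a unit multiple of
  `L₁ = (1, K, K+1, 2K−2)` (type A), `L₂ = (1, K+1, K+2, 2K−4)` (type B), `K = m/2`, or
  `L₃ = (1, K'+1, 2K'+1, 3K'−3)`, `K' = m/3` (type C);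
* **`not_isExceptionalQuadruple_eightDvd_nine`**: `Δ(m) = 0` — no Ausnahmequadrupel at these
  levels (the multiset form, the shape of the kernel sweeps `not_isExceptionalQuadruple_N`);
* **`thmB2m_standard_eightDvd_nine`**: the letter of the tree's named fact
  `AokiShioda1983_thmB2m_standard` (`HodgeTheory/FermatSurfaceHodgeCharacterStructure`) at these
  levels: every indecomposable primitive Hodge character is a permutation of `αᵢ`, `βᵢ` (`m = 2d`)
  or `γⱼ` (`m = 3d`) (via `letter_of_isStandardQuadruple`, `StandardQuadrupleLetter.lean`).
No level of this family lies in Aoki's computer range `m ≤ 630` (the first are `792 = 72·11`,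
`936 = 72·13`, `1800 = 72·25`); the levels `72·2ᵃ·{1, 5, 7, 35}` carry no good prime (`72, 144,
360, 504, 576` are kernel sweeps `ExceptionalQuadruples*`; [MeyerNeutsch1981Fermatquadrupel,
Tabelle 1]: `72` is exceptional). With the companion bridges (`StandardQuadrupleTwiceCoprime`,
`…FourTimesCoprime`, `…EightDvd`, `…ThreeOdd`, `…NineDvdOdd`, `…TwiceThree`, `…FourTimesThreeOdd`,
`…TwiceNine`, `…EightDvdThree`, `…FourTimesNine`) this is `Δ(m) = 0` at every level `m` carrying a
good prime.

HONEST FRAMING (cell `pub-hfermat`): explicit algebraic cycles for specific Hodge classes on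
Fermat/Delsarte varieties; residual open instances listed; no claim on general Hodge. (Surface
classes are algebraic by Lefschetz (1,1); this file restates a proved case of a structure theorem
for `𝔅²ₘ`.)

## References
* [Aoki1983] N. Aoki, Math. Ann. 266 (1983) 23–54, Thm. C and §9.
* [AokiShioda1983] N. Aoki, T. Shioda, Progr. Math. 35 (1983) 1–12, §2 Thm (𝔅²ₘ) (ii).
* [MeyerNeutsch1981Fermatquadrupel] W. Meyer, W. Neutsch, Math. Ann. 256 (1981) 51–62, (13)–(15)
  p. 53, Tabelle 1 p. 54.
-/

namespace Literature.AlgebraicGeometry.Shioda1982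

open Finset Multiset Literature.AlgebraicGeometry.HodgeTheory Literature.AlgebraicGeometry.HodgeTheory.FermatCharacter

section EightDvdNine

variable {m : ℕ} [NeZero m]

omit [NeZero m] in
/-- The multiset of values of a `4`-tuple, listed along four pairwise distinct indices. [folklore] -/
private theorem univ_val_map_eq_of_distinct₈₉ {X : Type*} (α : Fin 4 → X) (a b c d : Fin 4)
    (hab : a ≠ b) (hac : a ≠ c) (had : a ≠ d) (hbc : b ≠ c) (hbd : b ≠ d) (hcd : c ≠ d) :
    univ.val.map α = {α a, α b, α c, α d} := by
  classical
  have hc4 : #({a, b, c, d} : Finset (Fin 4)) = 4 := by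
    rw [Finset.card_insert_of_notMem (by simp [hab, hac, had]),
      Finset.card_insert_of_notMem (by simp [hbc, hbd]), Finset.card_pair hcd]
  have huniv : (univ : Finset (Fin 4)) = {a, b, c, d} :=
    (Finset.eq_univ_of_card _ (by rw [hc4]; simp)).symm
  rw [huniv, Finset.insert_val, Multiset.ndinsert_of_notMem (by simp [hab, hac, had]),
    Finset.insert_val, Multiset.ndinsert_of_notMem (by simp [hbc, hbd]), Finset.insert_val,
    Multiset.ndinsert_of_notMem (by simp [hcd]), Finset.singleton_val]
  simp only [Multiset.insert_eq_cons, Multiset.map_cons, Multiset.map_singleton]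

/-- A unit of `ℤ/m` (`3 ∣ m`) maps `K' = m/3` to `K'` or `2K'`, according to its residue mod `3`.
[folklore] -/
private theorem unit_mul_third₈₉ (h3 : 3 ∣ m) (t : (ZMod m)ˣ) :
    (t : ZMod m) * ((m / 3 : ℕ) : ZMod m) = ((m / 3 : ℕ) : ZMod m) ∨
      (t : ZMod m) * ((m / 3 : ℕ) : ZMod m) = 2 * ((m / 3 : ℕ) : ZMod m) := by
  have hcop : Nat.Coprime (t : ZMod m).val m := ZMod.val_coe_unit_coprime t
  have hK3 : (3 : ZMod m) * ((m / 3 : ℕ) : ZMod m) = 0 := by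
    have : ((3 * (m / 3) : ℕ) : ZMod m) = 0 := by
      rw [Nat.mul_div_cancel' h3]; exact ZMod.natCast_self _
    exact_mod_cast this
  have hr : (t : ZMod m).val % 3 = 1 ∨ (t : ZMod m).val % 3 = 2 := by
    have hne : (t : ZMod m).val % 3 ≠ 0 := fun h ↦ by
      have h0 : 3 ∣ (t : ZMod m).val := Nat.dvd_of_mod_eq_zero h
      have h31 : 3 ∣ Nat.gcd (t : ZMod m).val m := Nat.dvd_gcd h0 h3
      rw [Nat.Coprime.gcd_eq_one hcop] at h31
      exact absurd (Nat.le_of_dvd one_pos h31) (by norm_num)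
    omega
  have key : (t : ZMod m) * ((m / 3 : ℕ) : ZMod m) =
      (((t : ZMod m).val % 3 : ℕ) : ZMod m) * ((m / 3 : ℕ) : ZMod m) := by
    conv_lhs => rw [← ZMod.natCast_zmod_val (t : ZMod m), ← Nat.div_add_mod (t : ZMod m).val 3]
    push_cast
    linear_combination (((t : ZMod m).val / 3 : ℕ) : ZMod m) * hK3
  rcases hr with hr | hr
  · left; rw [key, hr]; push_cast; ring
  · right; rw [key, hr]; push_cast; ring

/-- **No exceptional quadruple at the levels `8 ∣ m`, `9 ∣ m`, `m` with a good prime:** the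
multiset of values of a pair-free primitive Hodge character of length `4` and level `m` is a
standard quadruple — a unit multiple of `L₁ = (1, K, K+1, 2K−2)` (type A, `t = x`; `x·K = K` for
the odd unit `x`), of `L₂ = (1, K+1, K+2, 2K−4)` (type B), `K = m/2`, or of
`L₃ = (1, K'+1, 2K'+1, 3K'−3)`, `K' = m/3` (type C; `x·K' ∈ {K', 2K'}`)
(`standard_of_isHodge_eightDvd_nine`).
[cite: Aoki1983, Thm. C] [cite: MeyerNeutsch1981Fermatquadrupel, (13)–(15) p. 53 (Standardquadrupel)] -/
theorem isStandardQuadruple_of_eightDvd_nine (h8 : 8 ∣ m) (h9 : 9 ∣ m)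
    {p : ℕ} (hp : p.Prime) (hpm : p ∣ m) (hbig : 11 ≤ p ∨ (5 ≤ p ∧ p ^ 2 ∣ m))
    {α : Fin 4 → ZMod m} (hα : IsHodge α)
    (hind : ∀ i j : Fin 4, i ≠ j → α i + α j ≠ 0) (hprim : ∀ g : ℕ, (∀ i, g ∣ (α i).val) → g = 1) :
    IsStandardQuadruple m (univ.val.map α) := by
  classical
  have h2 : 2 ∣ m := dvd_trans (by norm_num) h8
  have h3 : 3 ∣ m := dvd_trans (by norm_num) h9
  set H : ZMod m := ((m / 2 : ℕ) : ZMod m) with hH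
  have hHH : H + H = 0 := by
    rw [hH, ← Nat.cast_add, show m / 2 + m / 2 = m by omega, ZMod.natCast_self]
  have h3K : (3 : ZMod m) * ((m / 3 : ℕ) : ZMod m) = 0 := by
    have : ((3 * (m / 3) : ℕ) : ZMod m) = 0 := by
      rw [Nat.mul_div_cancel' h3]; exact ZMod.natCast_self _
    exact_mod_cast this
  rcases standard_of_isHodge_eightDvd_nine h8 h9 hp hpm hbig hα hprim with
    ⟨i, j, hij, h⟩ | ⟨i₀, j₁, j₂, j₃, h01, h02, h03, h12, h13, h23, hu, e1, e2, e3⟩ |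
    ⟨i₀, j₁, j₂, j₃, h01, h02, h03, h12, h13, h23, hu, e1, e2, e3⟩ |
    ⟨i₀, j₁, j₂, j₃, h01, h02, h03, h12, h13, h23, hu, e1, e2, e3⟩
  · exact absurd h (hind i j hij)
  · -- type A: `{x, -2x, x + m/2, m/2} = x · L₁`
    have hxH : (α i₀) * H = H := by
      have := half_mul_unit h2 hu.unit
      rw [IsUnit.unit_spec] at this
      rw [mul_comm (α i₀)]
      exact this
    refine ⟨hu.unit, Or.inl ⟨h2, Or.inl ?_⟩⟩
    rw [univ_val_map_eq_of_distinct₈₉ α i₀ j₁ j₂ j₃ h01 h02 h03 h12 h13 h23, e1, e2, e3, stdOne]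
    simp only [Multiset.insert_eq_cons, Multiset.map_cons, Multiset.map_singleton, IsUnit.unit_spec,
      mul_one]
    rw [show α i₀ * (H + 1) = α i₀ + H by rw [mul_add, hxH, mul_one, add_comm],
      show α i₀ * (2 * H - 2) = -2 * α i₀ by linear_combination (α i₀) * hHH, hxH]
    simp only [← Multiset.singleton_add]
    abel
  · -- type B: `{x, 2x + m/2, x + m/2, -4x} = x · L₂`
    have hxH : (α i₀) * H = H := by
      have := half_mul_unit h2 hu.unit
      rw [IsUnit.unit_spec] at this
      rw [mul_comm (α i₀)]
      exact this
    refine ⟨hu.unit, Or.inl ⟨h2, Or.inr ?_⟩⟩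
    rw [univ_val_map_eq_of_distinct₈₉ α i₀ j₁ j₂ j₃ h01 h02 h03 h12 h13 h23, e1, e2, e3, stdTwo]
    simp only [Multiset.insert_eq_cons, Multiset.map_cons, Multiset.map_singleton, IsUnit.unit_spec,
      mul_one]
    rw [show α i₀ * (H + 1) = α i₀ + H by rw [mul_add, hxH, mul_one, add_comm],
      show α i₀ * (H + 2) = 2 * α i₀ + H by rw [mul_add, hxH]; ring,
      show α i₀ * (2 * H - 4) = -4 * α i₀ by linear_combination (α i₀) * hHH]
    simp only [← Multiset.singleton_add]
    abel
  · -- type C: `{x, x + K', x + 2K', -3x} = x · L₃`, `K' = m/3`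
    refine ⟨hu.unit, Or.inr ⟨h3, ?_⟩⟩
    rcases unit_mul_third₈₉ h3 hu.unit with hxn | hxn <;> rw [IsUnit.unit_spec] at hxn
    · rw [univ_val_map_eq_of_distinct₈₉ α i₀ j₁ j₂ j₃ h01 h02 h03 h12 h13 h23, e1, e2, e3, stdThree]
      simp only [Multiset.insert_eq_cons, Multiset.map_cons, Multiset.map_singleton, IsUnit.unit_spec,
        mul_one]
      rw [show α i₀ * (((m / 3 : ℕ) : ZMod m) + 1) = α i₀ + ((m / 3 : ℕ) : ZMod m) by
            rw [mul_add, hxn, mul_one, add_comm],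
        show α i₀ * (2 * ((m / 3 : ℕ) : ZMod m) + 1) = α i₀ + 2 * ((m / 3 : ℕ) : ZMod m) by
            linear_combination 2 * hxn,
        show α i₀ * (3 * ((m / 3 : ℕ) : ZMod m) - 3) = -3 * α i₀ by
            linear_combination 3 * hxn + h3K]
    · -- `x ≡ 2 (mod 3)`: the middle entries are exchanged
      rw [univ_val_map_eq_of_distinct₈₉ α i₀ j₂ j₁ j₃ h02 h01 h03 h12.symm h23 h13, e1, e2, e3,
        stdThree]
      simp only [Multiset.insert_eq_cons, Multiset.map_cons, Multiset.map_singleton, IsUnit.unit_spec,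
        mul_one]
      rw [show α i₀ * (((m / 3 : ℕ) : ZMod m) + 1) = α i₀ + 2 * ((m / 3 : ℕ) : ZMod m) by
            rw [mul_add, hxn, mul_one, add_comm],
        show α i₀ * (2 * ((m / 3 : ℕ) : ZMod m) + 1) = α i₀ + ((m / 3 : ℕ) : ZMod m) by
            linear_combination 2 * hxn + h3K,
        show α i₀ * (3 * ((m / 3 : ℕ) : ZMod m) - 3) = -3 * α i₀ by
            linear_combination 3 * hxn + 2 * h3K]

/-! ### The multiset form: no exceptional quadruple at these levels -/

omit [NeZero m] in
/-- Divisibility of Meyer–Neutsch's `gcd(a₁, …, a_k, m)` (a right fold of `Nat.gcd`). [folklore] -/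
private theorem dvd_foldr_gcd₈₉ {d b : ℕ} {l : Multiset ℕ} (hb : d ∣ b) (hl : ∀ v ∈ l, d ∣ v) :
    d ∣ l.foldr Nat.gcd b := by
  induction l using Multiset.induction_on with
  | empty => simpa using hb
  | cons a l ih =>
    rw [Multiset.foldr_cons]
    exact Nat.dvd_gcd (hl a (Multiset.mem_cons_self a l))
      (ih fun v hv ↦ hl v (Multiset.mem_cons_of_mem hv))

omit [NeZero m] in
/-- A `4`-tuple whose multiset of values has no pair `a, -a` (as two members) is indecomposable.
[folklore] -/
private theorem indecomposable_of_not_hasPair₈₉ {α : Fin 4 → ZMod m}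
    (h : ¬ HasPair (univ.val.map α)) : ∀ i j : Fin 4, i ≠ j → α i + α j ≠ 0 := by
  classical
  intro i j hij hsum
  apply h
  refine ⟨α i, Multiset.mem_map.mpr ⟨i, Finset.mem_univ_val i, rfl⟩, ?_⟩
  have hneg : -α i = α j := by linear_combination (-1 : ZMod m) * hsum
  rw [hneg]
  by_cases he : α j = α i
  · have h2 : 2 ≤ Multiset.count (α i) (univ.val.map α) := by
      rw [count_univ_val_map]
      exact Finset.one_lt_card.mpr ⟨i, by simp, j, by simp [he], hij⟩
    rw [he, ← Multiset.count_pos, Multiset.count_erase_self]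
    omega
  · exact (Multiset.mem_erase_of_ne he).mpr (Multiset.mem_map.mpr ⟨j, Finset.mem_univ_val j, rfl⟩)

omit [NeZero m] in
/-- At an EVEN level `m`, Meyer–Neutsch primitivity `gcd(a₁, …, a₄, m) = 1` of the multiset of
values of a Hodge character gives `GCD(aᵢ) = 1` in the letter of the named fact (a common divisor
`g` of the `aᵢ` divides `∑ aᵢ = 2m` and is prime to `m`, so `g ∣ 2`, and `g = 2` is not prime to
the even `m`). [cite: MeyerNeutsch1981Fermatquadrupel, (9)–(10) p. 52] -/
private theorem forall_dvd_of_isPrimitive₈₉ (h2 : 2 ∣ m) {α : Fin 4 → ZMod m} (hα : IsHodge α)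
    (hp : IsPrimitive m (univ.val.map α)) : ∀ g : ℕ, (∀ i, g ∣ (α i).val) → g = 1 := by
  intro g hg
  have hsum : ∑ i, (α i).val = 2 * m := by
    have h1 := hα.2 1
    simp only [Units.val_one, one_mul] at h1
    change 2 * ∑ i, (α i).val = m * 4 at h1
    omega
  have hg4 : g ∣ 2 * m := hsum ▸ Finset.dvd_sum fun i _ ↦ hg i
  have hcop : Nat.Coprime g m := by
    have hd : Nat.gcd g m ∣ ((univ.val.map α).map ZMod.val).foldr Nat.gcd m := by
      refine dvd_foldr_gcd₈₉ (Nat.gcd_dvd_right _ _) fun v hv ↦ ?_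
      obtain ⟨a, ha, rfl⟩ := Multiset.mem_map.mp hv
      obtain ⟨i, -, rfl⟩ := Multiset.mem_map.mp ha
      exact (Nat.gcd_dvd_left _ _).trans (hg i)
    unfold IsPrimitive at hp
    rw [hp] at hd
    exact Nat.dvd_one.mp hd
  have hg2 : g ∣ 2 := hcop.dvd_of_dvd_mul_right hg4
  have hg0 : g ≠ 0 := fun h ↦ by
    rw [h] at hg2; exact absurd (Nat.eq_zero_of_zero_dvd hg2) two_ne_zero
  have hgle : g ≤ 2 := Nat.le_of_dvd two_pos hg2
  interval_cases g
  · exact absurd rfl hg0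
  · rfl
  · exfalso
    have h2' : Nat.gcd 2 m = 2 := Nat.gcd_eq_left h2
    have h1 := Nat.Coprime.gcd_eq_one hcop
    rw [h2'] at h1
    exact absurd h1 (by norm_num)

/-- **`Δ(m) = 0` at the levels `m` with `8 ∣ m`, `9 ∣ m`, `m` carrying a prime `p ≥ 11` or `p ≥ 5`
with `p² ∣ m`: there is NO exceptional quadruple (Ausnahmequadrupel) at these levels** — every
Hodge `4`-multiset without a pair `a, -a` and with `gcd(a₁, …, a₄, m) = 1` is a unit multiple of
`L₁`, `L₂` or `L₃` ([Aoki1983, Thm. C] at these levels, in the vocabulary of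
[MeyerNeutsch1981Fermatquadrupel] / [Shioda1982PicardFermat, Prop. 4]). E.g. `m = 792, 936, 1800`.
[cite: Aoki1983, Thm. C] [cite: MeyerNeutsch1981Fermatquadrupel, p. 53 (Standard- und Ausnahmequadrupel)] -/
theorem not_isExceptionalQuadruple_eightDvd_nine (h8 : 8 ∣ m) (h9 : 9 ∣ m)
    {p : ℕ} (hp : p.Prime) (hpm : p ∣ m) (hbig : 11 ≤ p ∨ (5 ≤ p ∧ p ^ 2 ∣ m))
    (s : Multiset (ZMod m)) : ¬ IsExceptionalQuadruple m s := by
  rintro ⟨h4, hs, hnp, hprim, hns⟩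
  obtain ⟨r, α, rfl⟩ := exists_eq_univ_val_map s
  have hr : r = 4 := by rw [card_univ_val_map] at h4; exact h4
  subst hr
  have hα : IsHodge α := (isHodge_iff_isHodgeMultiset α).2 hs
  exact hns (isStandardQuadruple_of_eightDvd_nine h8 h9 hp hpm hbig hα
    (indecomposable_of_not_hasPair₈₉ hnp)
    (forall_dvd_of_isPrimitive₈₉ (dvd_trans (by norm_num) h8) hα hprim))

/-- **Aoki–Shioda 1983, Theorem `(𝔅²ₘ)` (ii) at the levels `m` with `8 ∣ m`, `9 ∣ m` and a good
prime, in the letter of the tree's named fact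
`Literature.AlgebraicGeometry.HodgeTheory.AokiShioda1983_thmB2m_standard`:** every indecomposable
primitive Hodge character `α` of length `4` and level `m` is, after a permutation of the coordinates,
a) `(i, d + i, −2i, d)` or b) `(i, d + i, d + 2i, −4i)` with `m = 2d`, or c) `(j, d + j, 2d + j, −3j)`
with `m = 3d` (`1 ≤ i < d`, `(i, d) = 1`, …). This is the body of that fact at these `m` (for all such
`m`, not only `m > 180`): [Aoki1983, Thm. C] there (`isStandardQuadruple_of_eightDvd_nine`) and
the generic bridge `letter_of_isStandardQuadruple`.
[cite: AokiShioda1983, §2 Theorem (𝔅²ₘ) (ii) a), b), c), p. 3] [cite: Aoki1983, Thm. C] -/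
theorem thmB2m_standard_eightDvd_nine (h8 : 8 ∣ m) (h9 : 9 ∣ m)
    {p : ℕ} (hp : p.Prime) (hpm : p ∣ m) (hbig : 11 ≤ p ∨ (5 ≤ p ∧ p ^ 2 ∣ m))
    (α : Fin 4 → ZMod m) (hα : IsHodge α) (hind : ∀ i j : Fin 4, i ≠ j → α i + α j ≠ 0)
    (hprim : ∀ g : ℕ, (∀ i, g ∣ (α i).val) → g = 1) :
    ∃ σ : Equiv.Perm (Fin 4),
      (∃ d i : ℕ, m = 2 * d ∧ 1 ≤ i ∧ i < d ∧ Nat.Coprime i d ∧ 4 * i ≠ m ∧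
          ∀ k, α (σ k) = ![(i : ZMod m), (d : ZMod m) + i, -(2 * (i : ZMod m)), (d : ZMod m)] k) ∨
      (∃ d i : ℕ, m = 2 * d ∧ 1 ≤ i ∧ i < d ∧ Nat.Coprime i d ∧ 3 * i ≠ m ∧ 4 * i ≠ m ∧ 6 * i ≠ m ∧
          ∀ k, α (σ k) = ![(i : ZMod m), (d : ZMod m) + i, (d : ZMod m) + 2 * i, -(4 * (i : ZMod m))] k) ∨
      (∃ d j : ℕ, m = 3 * d ∧ 1 ≤ j ∧ j < d ∧ Nat.Coprime j d ∧ 6 * j ≠ m ∧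
          ∀ k, α (σ k) = ![(j : ZMod m), (d : ZMod m) + j, 2 * (d : ZMod m) + j, -(3 * (j : ZMod m))] k) :=
  letter_of_isStandardQuadruple hα.1.1 hind
    (isStandardQuadruple_of_eightDvd_nine h8 h9 hp hpm hbig hα hind hprim)

end EightDvdNine

end Literature.AlgebraicGeometry.Shioda1982
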